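import Summits.AtomisticToContinuum.BoseEinsteinCondensation.Theorems.BECInsertionCorrectorStaticResponseBoundWeakCoupling
import Summits.AtomisticToContinuum.BoseEinsteinCondensation.Theorems.BECInsertionCorrectorStaticResponseBoundFewBodyWindow
import HarnessLib

/-!
# The few-body half of the static response bound, quintic window: `LargeNHalf5 ⟸ CoreWeak5 ε`
# (line `stable-fraction-square-completion`, seat a1 layer; item stmt-AtomisticToContinuum-12057 — this file supports,
# does not close, the item)

Seat a1 sharpened the few-body window of the crux `StaticResponseBound` from `N⁸ρa³ > c` to the QUINTIC `N⁵ρa³ > c`.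
This file is the window-edge step of the reshaped skeleton: for every `ε > 0`, the `N⁵ρa³ > c` half of the crux
(`LargeNHalf5`) follows from its LINEAR-RESPONSE-WINDOW content `t² ≤ ε²ρa·max(ρa,|p|²)` (`CoreWeak5 ε`), because
outside the window the crux's inequality `Ineq` is free (`ineq_of_strong_coupling`: infrared floor `−|t|N`, ultraviolet
free square plus the dilute upper bound `E₀ ≤ KρaN`, the latter PROVED in the tree as
`exists_groundStateEnergy_toReal_le`).  The argument of `largeNHalf_of_coreWeak'` never uses the shape of the window in
`N`, so we first record it for an ARBITRARY large-`N` predicate `W ρ N` (`wc5_largeNHalf_of_coreWeak_of_window`, reusable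
for any future exponent) and then specialise to `W ρ N := c < N⁵·ρa³`.
-/

noncomputable section

namespace Summit.AtomisticToContinuum.BoseEinsteinCondensation.Cruxes.StaticResponseBound.FewBody5

open MeasureTheory Filter
open scoped ENNReal NNReal BigOperators
open Literature.MathematicalPhysics.QuantumManyBody.BoseGas
open Summit.AtomisticToContinuum.BoseEinsteinCondensation.Theses
open Summit.AtomisticToContinuum.BoseEinsteinCondensation.Theses.BECInsertionCorrector
open Summit.AtomisticToContinuum.BoseEinsteinCondensation.Theorems.StaticResponseBound.Negative
open Summit.AtomisticToContinuum.BoseEinsteinCondensation.Cruxes.StaticResponseBound.UvThomsonForceWave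
open Summit.AtomisticToContinuum.BoseEinsteinCondensation.Cruxes.StaticResponseBound.FewBody

/-- **Window-agnostic form.**  For every `ε > 0`, every potential `v` and every large-`N` predicate `W ρ N`
(e.g. `c < N⁵·ρa³`): if the dilute upper bound `E₀(v,N,(N/ρ)^{1/3}) ≤ KρaN` holds for `ρ < ρ₂`, `N ≥ 2`, and the
crux's inequality holds with constant `C₁` for `ρ < ρ₁`, `W ρ N`, `k ≠ 0` and `t` INSIDE the linear-response window
`t² ≤ ε²ρa·max(ρa,|p|²)`, then it holds for `ρ < min ρ₁ ρ₂`, `W ρ N`, `k ≠ 0` and EVERY `t`, with constant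
`max C₁ (max (1/ε) (1 + K/ε²))` (outside the window: `ineq_of_strong_coupling`; `N = 0`: `ineq_N_zero`). [folklore] -/
theorem wc5_largeNHalf_of_coreWeak_of_window {ε : ℝ} (hε : 0 < ε) {v : ℝ → ℝ≥0∞} {W : ℝ → ℕ → Prop}
    {ρ₁ ρ₂ C₁ K : ℝ} (hK : 0 < K)
    (hdil : ∀ ρ : ℝ, 0 < ρ → ρ < ρ₂ → ∀ N : ℕ, 2 ≤ N →
      (periodicGroundStateEnergy v N (sideLength ρ N)).toReal ≤ K * ρ * (scatteringLength v).toReal * N)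
    (hweak : ∀ ρ : ℝ, 0 < ρ → ρ < ρ₁ → ∀ N : ℕ, W ρ N →
      ∀ k : Fin 3 → ℤ, k ≠ 0 → ∀ t : ℝ,
        t ^ 2 ≤ ε ^ 2 * (ρ * (scatteringLength v).toReal) *
          max (ρ * (scatteringLength v).toReal) (psq (sideLength ρ N) k) →
        ∀ Ψ : PeriodicTrialState N (sideLength ρ N), periodicEnergy v Ψ ≠ ⊤ → Ineq v C₁ ρ N k t Ψ) :
    ∀ ρ : ℝ, 0 < ρ → ρ < min ρ₁ ρ₂ → ∀ N : ℕ, W ρ N →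
      ∀ k : Fin 3 → ℤ, k ≠ 0 → ∀ t : ℝ, ∀ Ψ : PeriodicTrialState N (sideLength ρ N),
        periodicEnergy v Ψ ≠ ⊤ → Ineq v (max C₁ (max (1 / ε) (1 + K / ε ^ 2))) ρ N k t Ψ := by
  intro ρ hρ hρlt N hW k hk t Ψ hΨ
  rcases Nat.eq_zero_or_pos N with hN | hN
  · subst hN
    exact ineq_N_zero v _ ρ k t Ψ hΨ
  · by_cases hwin : t ^ 2 ≤ ε ^ 2 * (ρ * (scatteringLength v).toReal) *
        max (ρ * (scatteringLength v).toReal) (psq (sideLength ρ N) k)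
    · exact ineq_mono_const (hweak ρ hρ (lt_of_lt_of_le hρlt (min_le_left _ _)) N hW k hk t hwin Ψ hΨ)
        (le_max_left _ _)
    · push Not at hwin
      have hE : 2 ≤ N → (periodicGroundStateEnergy v N (sideLength ρ N)).toReal ≤
          K * ρ * (scatteringLength v).toReal * N :=
        fun h2 => hdil ρ hρ (lt_of_lt_of_le hρlt (min_le_right _ _)) N h2
      exact ineq_mono_const (ineq_of_strong_coupling hε hK hρ hN hE hk hwin Ψ hΨ) (le_max_right _ _)

/-- **`LargeNHalf5 ⟸ CoreWeak5 ε` with the dilute upper bound as a hypothesis** (binder form; the quintic analogue of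
`largeNHalf_of_coreWeak'`).  Hypotheses: `ε > 0`; `E₀ ≤ KρaN` along `L = (N/ρ)^{1/3}` for `N ≥ 2` (text of
`exists_groundStateEnergy_toReal_le`); `CoreWeak5 ε` = the crux restricted to `N⁵ρa³ > c` and
`t² ≤ ε²ρa·max(ρa,|p|²)` (every `c > 0`).  Conclusion: the text of `LargeNHalf5`. [folklore] -/
theorem wc5_largeNHalf5_of_coreWeak5' {ε : ℝ} (hε : 0 < ε)
    (hK : ∀ v : ℝ → ℝ≥0∞, IsRepulsiveFiniteRange v →
      ∃ ρ₀ : ℝ, 0 < ρ₀ ∧ ∃ K : ℝ, 0 < K ∧ ∀ ρ : ℝ, 0 < ρ → ρ < ρ₀ → ∀ N : ℕ, 2 ≤ N →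
        (periodicGroundStateEnergy v N (sideLength ρ N)).toReal ≤
          K * ρ * (scatteringLength v).toReal * N)
    (hcore : ∀ v : ℝ → ℝ≥0∞, IsRepulsiveFiniteRange v → ∀ c : ℝ, 0 < c →
      ∃ ρ₀ : ℝ, 0 < ρ₀ ∧ ∃ C : ℝ, 0 < C ∧
        ∀ ρ : ℝ, 0 < ρ → ρ < ρ₀ → ∀ N : ℕ,
          c < (N : ℝ) ^ 5 * (ρ * (scatteringLength v).toReal ^ 3) →
          ∀ k : Fin 3 → ℤ, k ≠ 0 → ∀ t : ℝ,
            t ^ 2 ≤ ε ^ 2 * (ρ * (scatteringLength v).toReal) *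
              max (ρ * (scatteringLength v).toReal) (psq (sideLength ρ N) k) →
            ∀ Ψ : PeriodicTrialState N (sideLength ρ N), periodicEnergy v Ψ ≠ ⊤ → Ineq v C ρ N k t Ψ) :
    ∀ v : ℝ → ℝ≥0∞, IsRepulsiveFiniteRange v → ∀ c : ℝ, 0 < c →
      ∃ ρ₀ : ℝ, 0 < ρ₀ ∧ ∃ C : ℝ, 0 < C ∧
        ∀ ρ : ℝ, 0 < ρ → ρ < ρ₀ → ∀ N : ℕ,
          c < (N : ℝ) ^ 5 * (ρ * (scatteringLength v).toReal ^ 3) →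
          ∀ k : Fin 3 → ℤ, k ≠ 0 → ∀ t : ℝ, ∀ Ψ : PeriodicTrialState N (sideLength ρ N),
            periodicEnergy v Ψ ≠ ⊤ → Ineq v C ρ N k t Ψ := by
  intro v hv c hc
  obtain ⟨ρ₁, hρ₁, C₁, hC₁, hweak⟩ := hcore v hv c hc
  obtain ⟨ρ₂, hρ₂, K, hK0, hdil⟩ := hK v hv
  exact ⟨min ρ₁ ρ₂, lt_min hρ₁ hρ₂, max C₁ (max (1 / ε) (1 + K / ε ^ 2)),
    lt_of_lt_of_le hC₁ (le_max_left _ _),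
    wc5_largeNHalf_of_coreWeak_of_window
      (W := fun ρ N => c < (N : ℝ) ^ 5 * (ρ * (scatteringLength v).toReal ^ 3)) hε hK0 hdil hweak⟩

/-- **Stub `stub_largeNHalf5_of_coreWeak5` (window edge, quintic).**  For every `ε > 0`, the `N⁵ρa³ > c` half of the
crux follows from its linear-response-window content `t² ≤ ε²ρa·max(ρa,|p|²)` (outside the window the inequality is
free: Dyson upper bound `E₀ ≤ KρaN`, proved as `exists_groundStateEnergy_toReal_le`, and the trivial bound `−|t|N`).
[folklore] -/
theorem stub_largeNHalf5_of_coreWeak5 :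
    ∀ {ε : ℝ}, 0 < ε →
    (∀ v : ℝ → ℝ≥0∞, IsRepulsiveFiniteRange v → ∀ c : ℝ, 0 < c →
      ∃ ρ₀ : ℝ, 0 < ρ₀ ∧ ∃ C : ℝ, 0 < C ∧
        ∀ ρ : ℝ, 0 < ρ → ρ < ρ₀ → ∀ N : ℕ,
          c < (N : ℝ) ^ 5 * (ρ * (scatteringLength v).toReal ^ 3) →
          ∀ k : Fin 3 → ℤ, k ≠ 0 → ∀ t : ℝ,
            t ^ 2 ≤ ε ^ 2 * (ρ * (scatteringLength v).toReal) *
              max (ρ * (scatteringLength v).toReal) (psq (sideLength ρ N) k) →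
            ∀ Ψ : PeriodicTrialState N (sideLength ρ N), periodicEnergy v Ψ ≠ ⊤ → Ineq v C ρ N k t Ψ) →
    ∀ v : ℝ → ℝ≥0∞, IsRepulsiveFiniteRange v → ∀ c : ℝ, 0 < c →
      ∃ ρ₀ : ℝ, 0 < ρ₀ ∧ ∃ C : ℝ, 0 < C ∧
        ∀ ρ : ℝ, 0 < ρ → ρ < ρ₀ → ∀ N : ℕ,
          c < (N : ℝ) ^ 5 * (ρ * (scatteringLength v).toReal ^ 3) →
          ∀ k : Fin 3 → ℤ, k ≠ 0 → ∀ t : ℝ, ∀ Ψ : PeriodicTrialState N (sideLength ρ N),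
            periodicEnergy v Ψ ≠ ⊤ → Ineq v C ρ N k t Ψ :=
  fun hε hcore => wc5_largeNHalf5_of_coreWeak5' hε (fun _ hv => exists_groundStateEnergy_toReal_le hv) hcore

/-- Conversely `LargeNHalf5` implies `CoreWeak5 ε` for every `ε` (drop the window hypothesis), so the two are
EQUIVALENT for every `ε > 0`. [folklore] -/
theorem wc5_coreWeak5_of_largeNHalf5 (ε : ℝ)
    (h : ∀ v : ℝ → ℝ≥0∞, IsRepulsiveFiniteRange v → ∀ c : ℝ, 0 < c →
      ∃ ρ₀ : ℝ, 0 < ρ₀ ∧ ∃ C : ℝ, 0 < C ∧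
        ∀ ρ : ℝ, 0 < ρ → ρ < ρ₀ → ∀ N : ℕ,
          c < (N : ℝ) ^ 5 * (ρ * (scatteringLength v).toReal ^ 3) →
          ∀ k : Fin 3 → ℤ, k ≠ 0 → ∀ t : ℝ, ∀ Ψ : PeriodicTrialState N (sideLength ρ N),
            periodicEnergy v Ψ ≠ ⊤ → Ineq v C ρ N k t Ψ) :
    ∀ v : ℝ → ℝ≥0∞, IsRepulsiveFiniteRange v → ∀ c : ℝ, 0 < c →
      ∃ ρ₀ : ℝ, 0 < ρ₀ ∧ ∃ C : ℝ, 0 < C ∧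
        ∀ ρ : ℝ, 0 < ρ → ρ < ρ₀ → ∀ N : ℕ,
          c < (N : ℝ) ^ 5 * (ρ * (scatteringLength v).toReal ^ 3) →
          ∀ k : Fin 3 → ℤ, k ≠ 0 → ∀ t : ℝ,
            t ^ 2 ≤ ε ^ 2 * (ρ * (scatteringLength v).toReal) *
              max (ρ * (scatteringLength v).toReal) (psq (sideLength ρ N) k) →
            ∀ Ψ : PeriodicTrialState N (sideLength ρ N), periodicEnergy v Ψ ≠ ⊤ → Ineq v C ρ N k t Ψ := by
  intro v hv c hc
  obtain ⟨ρ₀, hρ₀, C, hC, hbody⟩ := h v hv c hc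
  exact ⟨ρ₀, hρ₀, C, hC, fun ρ hρ hρlt N hN5 k hk t _ Ψ hΨ => hbody ρ hρ hρlt N hN5 k hk t Ψ hΨ⟩

end Summit.AtomisticToContinuum.BoseEinsteinCondensation.Cruxes.StaticResponseBound.FewBody5

end
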